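import Literature.MathematicalPhysics.QuantumFieldTheory.Balaban1983to89.B9OpsRTransport
import Literature.MathematicalPhysics.QuantumFieldTheory.Balaban1983to89.B9Thm312Whole
import Literature.MathematicalPhysics.QuantumFieldTheory.Balaban1983to89.B9Thm312WholeBlocksNbr
import Literature.MathematicalPhysics.QuantumFieldTheory.Balaban1983to89.B9Thm312WholeClasses
import Literature.MathematicalPhysics.QuantumFieldTheory.Balaban1983to89.B9Thm312WholeDir
import Literature.MathematicalPhysics.QuantumFieldTheory.Balaban1983to89.B9Thm312WholeL2
import Literature.MathematicalPhysics.QuantumFieldTheory.Balaban1983to89.B9Thm312WholeRightStepFrom3131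
import Literature.MathematicalPhysics.QuantumFieldTheory.Balaban1983to89.B9Thm312WholeStepDirFrom3131
import Literature.MathematicalPhysics.QuantumFieldTheory.Balaban1983to89.B9Thm312WholeStepFrom3131
import Literature.MathematicalPhysics.QuantumFieldTheory.Balaban1983to89.B9Thm313Whole
import Literature.MathematicalPhysics.QuantumFieldTheory.Balaban1983to89.B9Thm313WholeDir
import Literature.MathematicalPhysics.QuantumFieldTheory.Balaban1983to89.B9Thm313WholeDirInputB
import Literature.MathematicalPhysics.QuantumFieldTheory.Balaban1983to89.B9Thm313WholeDirInputBC
import Literature.MathematicalPhysics.QuantumFieldTheory.Balaban1983to89.B9Thm313WholeDirL2Z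
import Literature.MathematicalPhysics.QuantumFieldTheory.Balaban1983to89.B9Thm313WholeDirZ
import Literature.MathematicalPhysics.QuantumFieldTheory.Balaban1983to89.B9Thm313WholeHolder
import Literature.MathematicalPhysics.QuantumFieldTheory.Balaban1983to89.B9Thm313WholeHolderZ
import Literature.MathematicalPhysics.QuantumFieldTheory.Balaban1983to89.B9Thm313WholeInput
import Literature.MathematicalPhysics.QuantumFieldTheory.Balaban1983to89.B9Thm313WholeL2G
import Literature.MathematicalPhysics.QuantumFieldTheory.Balaban1983to89.B9Thm313WholeL2GP
import Literature.MathematicalPhysics.QuantumFieldTheory.Balaban1983to89.B9Thm313WholeL2GPZ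
import Literature.MathematicalPhysics.QuantumFieldTheory.Balaban1983to89.B9Thm313WholeL2GZ
import Literature.MathematicalPhysics.QuantumFieldTheory.Balaban1983to89.B9Thm313WholeLeft
import Literature.MathematicalPhysics.QuantumFieldTheory.Balaban1983to89.B9Thm313WholeLeftZ
import Literature.MathematicalPhysics.QuantumFieldTheory.Balaban1983to89.B9Thm313WholeLettersCut
import Literature.MathematicalPhysics.QuantumFieldTheory.Balaban1983to89.B9Thm313WholeLettersCutKept
import Literature.MathematicalPhysics.QuantumFieldTheory.Balaban1983to89.B9Thm313WholeZ
import Literature.MathematicalPhysics.QuantumFieldTheory.Balaban1983to89.B9Thm312WholeIdentitiesSplit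
import Literature.MathematicalPhysics.QuantumFieldTheory.Balaban1983to89.B9Thm313WholeRgdFrom3152
import Literature.MathematicalPhysics.QuantumFieldTheory.Balaban1983to89.B9Thm312WholeLeft
import Literature.MathematicalPhysics.QuantumFieldTheory.Balaban1983to89.B9Thm312WholeH
import Literature.MathematicalPhysics.QuantumFieldTheory.Balaban1983to89.B9Thm312WholeHHolder
import Literature.MathematicalPhysics.QuantumFieldTheory.Balaban1983to89.B9Thm312WholeHZ
import Literature.MathematicalPhysics.QuantumFieldTheory.Balaban1983to89.B9Thm312WholeDirB

/-!
# `Balaban1983to89.B9OpsRTransportSectD` — Stage-3′(Y) MODULE 3-R, §3 sequel: the schema equivalences of the Sect.-D layer (Theorem 3.3's `G₀` letters read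
# inside Theorems 3.12–3.13, the (3.131) ∕ (3.137) step letters and steps, the Sect.-D identities, the Theorem-3.13 letter schemas) under the operator-letter
# transport `ops312RY` of `B9OpsRTransport`

statement-level skeleton of published theorems with citation tags; proofs where landed; nothing here is a claim about the Yang–Mills mass gap

B9 = T. Bałaban, *Propagators for lattice gauge theories in a background field*, Commun. Math. Phys. **99** (1985) 389–434 [Balaban1985BackgroundPropagators].
THE PRINT.  pp. 394–399 (Theorem 3.3, (3.39)–(3.47)), pp. 420–426 ((3.126), (3.130)–(3.137), Theorems 3.12–3.13 with (3.147)–(3.153)): every operator there is a function of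
the configuration `U` alone; the regularity conditions (3.35)–(3.36) p. 396 are hypotheses on `U`.  In the tree the Sect.-D letter record `B9Thm312Whole.Ops g B X Y Z W` and
every schema over it read the background `B` only through `B.Cfg`, and `bg9YR R₁ R₂ x` ∕ `bg9Y x` have the same configurations (`B9BackgroundsKLevelV1R.bg9YR_Cfg_eq`, `rfl`).

WHY THIS FILE (pub-ymgap bus 2026-08-28: dag-n06-d g13 WORD «(B) one fieldwise re-typing» + «Sect.-D schema bridges (rows 20–21) = sequel when the R-edition reaches them»;
node00-def-Y g24 LANDED-57 `B9OpsRTransport` = the transports + the Theorem-3.7 ∕ 3.10 bridges + `letters3131H_iff` ∕ `lettersHZ_iff`).  This sequel supplies the remaining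
Sect.-D bridges so the STEP-3 R-edition of the N06 certificate consumes every `B9Thm312Whole.Ops`-typed Y-face of rows 20–21 UNCHANGED at `ops312RY 𝔬` (probes at
`holderProbesRY 𝔭`), exactly as rows 18–19 do at `opsRY 𝔬`.  A separate module (not a re-land of `B9OpsRTransport`) so that nothing landed is modified.

WHAT THIS FILE DOES (one `↔` per schema, each by `cases ∕ constructor ∕ assumption` — the field types agree definitionally; nothing of [B9] asserted):
* §1 ★★ Theorem 3.3's `G₀` schemas: `Thm33G0`, `Thm33G0H`, `Thm33G0L2P`, `Thm33G0L2M` (extends `Thm33G0L2P`: parent transported by `thm33G0L2P_iff`), `Thm33G0L2`, `Thm33G0Dir`,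
  `Thm33G0DirX`, `Thm33G0DirR`, `Thm33G0DivR`.
* §2 ★★ the (3.131) ∕ (3.137) step letters: `Letters3131`, `Letters3131R` (`Letters3131H` is in `B9OpsRTransport`).
* §3 ★★ Theorem 3.13's letter schemas: `Letters313`, `Letters313D`, `Letters313DZ`, `Letters313DM`, `Letters313DMZ`, `Letters313H`, `Letters313HZ`, `Letters313HZc`, `Letters313I`,
  `Letters313IM`, `Letters313IMB`, `Letters313IMBC`, `Letters313IML`, `Letters313L2`, `Letters313L2Z`, `Letters313L2P`, `Letters313L2PZ`, `Letters313L2Pc`, `Letters313L2Pk`,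
  `Letters313L2M`, `Letters313L2MZ`, `Letters313Z`, `Letters313Zc`, `Letters313Zk`.
* §4 ★★ the remaining schemas over the record: the identities `Identities` (bridge named `identities312_iff`, since `B9OpsRTransport.identities_iff` is Theorem 3.7's),
  `IdentitiesDef`, `Ids3124`, `Ids3152`; the form smallness `FormSmall`; the (3.130) ∕ (3.137) steps `Step`, `StepL2`, `StepH`, `StepDir`, `StepDirB`, `LeftStep`; the `H`-letters
  `LettersH`, `LettersHH`, `LettersHHZ` (dag-n06-d g13's ask: the output schema of dag-n06-w5's `lettersHHZ_pins`).
CENSUS (2026-08-28): the tree has 51 `structure … (𝔬 : Ops g B X Y Z W) … : Prop` schemas (`rg` over `Balaban1983to89/B9*.lean`); all 51 are now bridged — 49 here,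
`Letters3131H` ∕ `LettersHZ` in `B9OpsRTransport`.
The geometry `g` is generic; the schemas' own remaining arguments are carried verbatim (`U : (bg9Y 𝔸 G x).Cfg` serves both sides).

HONEST SCOPE.  Bookkeeping only: tautological equivalences of predicates reading the background only through its configurations; no inequality, expansion or identity of
the paper is proved or asserted; no class-content implication between `R₁ ∕ R₂` and MODULE 3's families is assumed (RULING-2 (c): displayed by the edition).  Nothing landed
is modified; N06 is NOT discharged; NOT continuum, NOT OS, NOT the mass gap.  Filed by the pub-ymgap def-Y owner lineage (`pub-ymgap-node00-def-Y`, gen 24).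
Net new unproved facts: 0.
-/

noncomputable section

namespace Literature.MathematicalPhysics.QuantumFieldTheory.Balaban1983to89.B9OpsRTransportSectD

open B9PinMembersKLevelV1 (MemberY bg9Y)
open B9BackgroundsKLevelV1R (RegFamY bg9YR)
open B9OpsRTransport (ops312RY holderProbesRY)
open B9Thm34Ext (toB6)
open B11SectG (BlockNorm)
open B9RWSums343Holder (HolderProbes)
open B9Thm312Whole (Ops GeoOK Thm33G0 FormSmall Identities Step)
open B9Thm312WholeBlocksNbr (Thm33G0L2P)
open B9Thm312WholeClasses (Thm33G0H StepH)
open B9Thm312WholeDir (Thm33G0Dir Thm33G0L2M StepDir)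
open B9Thm312WholeL2 (Thm33G0L2 StepL2)
open B9Thm312WholeRightStepFrom3131 (Letters3131R Thm33G0DivR)
open B9Thm312WholeStepDirFrom3131 (Thm33G0DirX)
open B9Thm312WholeStepFrom3131 (Letters3131)
open B9Thm313Whole (Letters313)
open B9Thm313WholeDir (Thm33G0DirR Letters313DM Letters313L2M Letters313IM)
open B9Thm313WholeDirInputB (Letters313IMB)
open B9Thm313WholeDirInputBC (Letters313IMBC Letters313IML)
open B9Thm313WholeDirL2Z (Letters313L2MZ)
open B9Thm313WholeDirZ (Letters313DMZ)
open B9Thm313WholeHolder (Letters313H)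
open B9Thm313WholeHolderZ (Letters313HZ)
open B9Thm313WholeInput (Letters313I)
open B9Thm313WholeL2G (Letters313L2)
open B9Thm313WholeL2GP (Letters313L2P)
open B9Thm313WholeL2GPZ (Letters313L2PZ)
open B9Thm313WholeL2GZ (Letters313L2Z)
open B9Thm313WholeLeft (Letters313D)
open B9Thm313WholeLeftZ (Letters313DZ)
open B9Thm313WholeLettersCut (Letters313Zc Letters313HZc Letters313L2Pc)
open B9Thm313WholeLettersCutKept (Letters313L2Pk Letters313Zk)
open B9Thm313WholeZ (Letters313Z)
open B9Thm312WholeIdentitiesSplit (IdentitiesDef Ids3124)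
open B9Thm313WholeRgdFrom3152 (Ids3152)
open B9Thm312WholeLeft (LeftStep)
open B9Thm312WholeH (LettersH)
open B9Thm312WholeHHolder (LettersHH)
open B9Thm312WholeHZ (LettersHHZ)
open B9Thm312WholeDirB (StepDirB)

variable {d ℓ : ℕ} {hd : 1 ≤ d + 1} {hL : Odd (ℓ + 1) ∧ 1 < ℓ + 1} {b₀ b₁ : ℝ} {Mstar : ℕ}
variable {𝔸 : Type} [NormedRing 𝔸] [NormedAlgebra ℂ 𝔸] [CompleteSpace 𝔸] {G : Subgroup 𝔸ˣ}
variable {R₁ R₂ : RegFamY d ℓ hd hL b₀ b₁ Mstar 𝔸} {x : MemberY d ℓ hd hL b₀ b₁ Mstar} {g : B9.Geometry}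
variable [Fintype g.Site] {X Y Z W PX PY P : Type} [Fintype X] [Fintype Y] [Fintype Z] [Fintype W] [Fintype PX] [Fintype PY] [Fintype P]
variable (𝔬 : Ops g (bg9YR 𝔸 G R₁ R₂ x) X Y Z W) (𝔭 : HolderProbes g (bg9YR 𝔸 G R₁ R₂ x) X Y PX PY)

/-! ## §1 ★★ Theorem 3.3's `G₀` schemas read inside Theorems 3.12–3.13 -/

omit [Fintype X] [Fintype Y] [Fintype Z] [Fintype W] in
/-- `Thm33G0` under the transport. [cite: Balaban1985BackgroundPropagators, Thm 3.3 p.399 + (3.42) p.397, bookkeeping] -/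
theorem thm33G0_iff (R₀ : ℝ) (H₀ : Prop) (B₀ δ₀ : ℝ) (U : (bg9Y 𝔸 G x).Cfg) :
    Thm33G0 (ops312RY 𝔬) R₀ H₀ B₀ δ₀ U ↔ Thm33G0 𝔬 R₀ H₀ B₀ δ₀ U := by
  constructor <;> rintro ⟨⟩ <;> constructor <;> assumption
omit [Fintype X] [Fintype Z] [Fintype W] [Fintype PX] in
/-- `Thm33G0H` under the transport. [cite: Balaban1985BackgroundPropagators, Thm 3.3 p.399 + (3.43)–(3.45) p.398 + (3.40) p.397, bookkeeping] -/
theorem thm33G0H_iff (R₀ : ℝ) (H₀ : Prop) (bH : ℝ → BlockNorm (toB6 g R₀ H₀) (Y → ℝ)) (Bh Bi : ℝ → ℝ) (Bi2 : ℝ → ℝ → ℝ) (δ₀ : ℝ) (U : (bg9Y 𝔸 G x).Cfg) :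
    Thm33G0H (ops312RY 𝔬) (holderProbesRY 𝔭) R₀ H₀ bH Bh Bi Bi2 δ₀ U ↔ Thm33G0H 𝔬 𝔭 R₀ H₀ bH Bh Bi Bi2 δ₀ U := by
  constructor <;> rintro ⟨⟩ <;> constructor <;> assumption
omit [Fintype Z] [Fintype W] [Fintype P] in
/-- `Thm33G0L2P` under the transport. [cite: Balaban1985BackgroundPropagators, Thm 3.3 p.399 + (3.46) p.398 + (3.39) p.397 + p.398 (remark after (3.47)), bookkeeping] -/
theorem thm33G0L2P_iff (Dd Dds : (bg9Y 𝔸 G x).Cfg → P → Module.End ℝ (X → ℝ)) (R₀ : ℝ) (H₀ : Prop) (B₂ δ₁ : ℝ) (U : (bg9Y 𝔸 G x).Cfg) :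
    Thm33G0L2P (ops312RY 𝔬) Dd Dds R₀ H₀ B₂ δ₁ U ↔ Thm33G0L2P 𝔬 Dd Dds R₀ H₀ B₂ δ₁ U := by
  constructor <;> rintro ⟨⟩ <;> constructor <;> assumption
omit [Fintype Z] [Fintype W] [Fintype P] in
/-- `Thm33G0L2M` under the transport. [cite: Balaban1985BackgroundPropagators, Thm 3.3 p.399 + (3.46) p.398 + (3.39) p.397 + p.398 (remark after (3.47)), bookkeeping] -/
theorem thm33G0L2M_iff (Dd Dds : (bg9Y 𝔸 G x).Cfg → P → Module.End ℝ (X → ℝ)) (R₀ : ℝ) (H₀ : Prop) (B₂ δ₁ : ℝ) (U : (bg9Y 𝔸 G x).Cfg) :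
    Thm33G0L2M (ops312RY 𝔬) Dd Dds R₀ H₀ B₂ δ₁ U ↔ Thm33G0L2M 𝔬 Dd Dds R₀ H₀ B₂ δ₁ U := by
  constructor
  · rintro ⟨hp, h1, h2, h3⟩; exact ⟨(thm33G0L2P_iff 𝔬 Dd Dds R₀ H₀ B₂ δ₁ U).1 hp, h1, h2, h3⟩
  · rintro ⟨hp, h1, h2, h3⟩; exact ⟨(thm33G0L2P_iff 𝔬 Dd Dds R₀ H₀ B₂ δ₁ U).2 hp, h1, h2, h3⟩
omit [Fintype Z] [Fintype W] in
/-- `Thm33G0L2` under the transport. [cite: Balaban1985BackgroundPropagators, Thm 3.3 p.399 + (3.46) p.398 + p.398 (remark after (3.47)), bookkeeping] -/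
theorem thm33G0L2_iff (Lap : (bg9Y 𝔸 G x).Cfg → Module.End ℝ (X → ℝ)) (R₀ : ℝ) (H₀ : Prop) (B₂ δ₁ : ℝ) (U : (bg9Y 𝔸 G x).Cfg) :
    Thm33G0L2 (ops312RY 𝔬) Lap R₀ H₀ B₂ δ₁ U ↔ Thm33G0L2 𝔬 Lap R₀ H₀ B₂ δ₁ U := by
  constructor <;> rintro ⟨⟩ <;> constructor <;> assumption
omit [Fintype Y] [Fintype Z] [Fintype W] [Fintype PY] [Fintype P] in
/-- `Thm33G0Dir` under the transport. [cite: Balaban1985BackgroundPropagators, Thm 3.3 p.399 + (3.42)–(3.45) p.398 + (3.39)–(3.40) p.397, bookkeeping] -/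
theorem thm33G0Dir_iff (Dd Dds : (bg9Y 𝔸 G x).Cfg → P → Module.End ℝ (X → ℝ)) (R₀ : ℝ) (H₀ : Prop) (bHX : ℝ → BlockNorm (toB6 g R₀ H₀) (X → ℝ)) (B₀ : ℝ)
    (Bh Bi : ℝ → ℝ) (Bi2 : ℝ → ℝ → ℝ) (δ₀ : ℝ) (U : (bg9Y 𝔸 G x).Cfg) :
    Thm33G0Dir (ops312RY 𝔬) (holderProbesRY 𝔭) Dd Dds R₀ H₀ bHX B₀ Bh Bi Bi2 δ₀ U ↔ Thm33G0Dir 𝔬 𝔭 Dd Dds R₀ H₀ bHX B₀ Bh Bi Bi2 δ₀ U := by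
  constructor <;> rintro ⟨⟩ <;> constructor <;> assumption
omit [Fintype Y] [Fintype Z] [Fintype W] [Fintype PY] [Fintype P] in
/-- `Thm33G0DirX` under the transport. [cite: Balaban1985BackgroundPropagators, Thm 3.3 p.399 + (3.42)–(3.45) pp.397–398 + (3.39)–(3.40) p.397 + p.398 (remarks after (3.47)) + p.423, bookkeeping] -/
theorem thm33G0DirX_iff (Dd : (bg9Y 𝔸 G x).Cfg → P → Module.End ℝ (X → ℝ)) (R₀ : ℝ) (H₀ : Prop) (hlen : ∀ y : g.Site, 0 ≤ g.len y)
    (bH : BlockNorm (toB6 g R₀ H₀) (W → ℝ)) (Bx0 BdX : ℝ → ℝ) (δ₀ δ₃ : ℝ) (U : (bg9Y 𝔸 G x).Cfg) :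
    Thm33G0DirX (ops312RY 𝔬) (holderProbesRY 𝔭) Dd R₀ H₀ hlen bH Bx0 BdX δ₀ δ₃ U ↔ Thm33G0DirX 𝔬 𝔭 Dd R₀ H₀ hlen bH Bx0 BdX δ₀ δ₃ U := by
  constructor <;> rintro ⟨⟩ <;> constructor <;> assumption
omit [Fintype X] [Fintype Y] [Fintype Z] [Fintype W] [Fintype P] in
/-- `Thm33G0DirR` under the transport. [cite: Balaban1985BackgroundPropagators, Thm 3.3 p.399 + (3.42) p.397 + (3.39) p.397, bookkeeping] -/
theorem thm33G0DirR_iff (Dds : (bg9Y 𝔸 G x).Cfg → P → Module.End ℝ (X → ℝ)) (R₀ : ℝ) (H₀ : Prop) (B₀ δ₀ : ℝ) (U : (bg9Y 𝔸 G x).Cfg) :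
    Thm33G0DirR (ops312RY 𝔬) Dds R₀ H₀ B₀ δ₀ U ↔ Thm33G0DirR 𝔬 Dds R₀ H₀ B₀ δ₀ U := by
  constructor <;> rintro ⟨⟩ <;> constructor <;> assumption
omit [Fintype X] [Fintype Y] [Fintype Z] [Fintype P] in
/-- `Thm33G0DivR` under the transport. [cite: Balaban1985BackgroundPropagators, Thm 3.3 p.399 + (3.44) p.398 + p.398 (remarks after (3.47)) + (3.39) p.397, bookkeeping] -/
theorem thm33G0DivR_iff (Dds : (bg9Y 𝔸 G x).Cfg → P → Module.End ℝ (X → ℝ)) (R₀ : ℝ) (H₀ : Prop) (hlen : ∀ y : g.Site, 0 ≤ g.len y)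
    (bHX : ℝ → BlockNorm (toB6 g R₀ H₀) (X → ℝ)) (bHW : ℝ → BlockNorm (toB6 g R₀ H₀) (W → ℝ)) (BiD BdD : ℝ → ℝ) (δ₀ δ₃ : ℝ) (U : (bg9Y 𝔸 G x).Cfg) :
    Thm33G0DivR (ops312RY 𝔬) Dds R₀ H₀ hlen bHX bHW BiD BdD δ₀ δ₃ U ↔ Thm33G0DivR 𝔬 Dds R₀ H₀ hlen bHX bHW BiD BdD δ₀ δ₃ U := by
  constructor <;> rintro ⟨⟩ <;> constructor <;> assumption

/-! ## §2 ★★ The (3.131) ∕ (3.137) step letters -/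

omit [Fintype Y] [Fintype Z] in
/-- `Letters3131` under the transport. [cite: Balaban1985BackgroundPropagators, (3.130)–(3.131) pp.421–422 + (3.135)–(3.137) pp.422–423 + p.398 (remark after (3.47)), bookkeeping] -/
theorem letters3131_iff (Ta Ta₂ : (bg9Y 𝔸 G x).Cfg → Module.End ℝ (X → ℝ)) (Tb Tb₂ : (bg9Y 𝔸 G x).Cfg → (X → ℝ) →ₗ[ℝ] (W → ℝ)) (R₀ : ℝ) (H₀ : Prop)
    (hlen : ∀ y : g.Site, 0 ≤ g.len y) (t δT : ℝ) (U : (bg9Y 𝔸 G x).Cfg) :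
    Letters3131 (ops312RY 𝔬) Ta Ta₂ Tb Tb₂ R₀ H₀ hlen t δT U ↔ Letters3131 𝔬 Ta Ta₂ Tb Tb₂ R₀ H₀ hlen t δT U := by
  constructor <;> rintro ⟨⟩ <;> constructor <;> assumption
omit [Fintype Y] [Fintype Z] in
/-- `Letters3131R` under the transport. [cite: Balaban1985BackgroundPropagators, (3.130)–(3.131) pp.421–422 + (3.135)–(3.137) pp.422–423 + p.398 (remark after (3.47)), bookkeeping] -/
theorem letters3131R_iff (Ta Ta₂ : (bg9Y 𝔸 G x).Cfg → Module.End ℝ (X → ℝ)) (Tb Tb₂ : (bg9Y 𝔸 G x).Cfg → (W → ℝ) →ₗ[ℝ] (X → ℝ)) (R₀ : ℝ) (H₀ : Prop)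
    (hlen : ∀ y : g.Site, 0 ≤ g.len y) (t δT : ℝ) (U : (bg9Y 𝔸 G x).Cfg) :
    Letters3131R (ops312RY 𝔬) Ta Ta₂ Tb Tb₂ R₀ H₀ hlen t δT U ↔ Letters3131R 𝔬 Ta Ta₂ Tb Tb₂ R₀ H₀ hlen t δT U := by
  constructor <;> rintro ⟨⟩ <;> constructor <;> assumption

/-! ## §3 ★★ Theorem 3.13's letter schemas -/

/-- `Letters313` under the transport. [cite: Balaban1985BackgroundPropagators, Thm 3.13 p.426 + (3.152)–(3.153) p.426 + (3.132) p.422 + (3.126) p.420 + p.398 (remark after (3.47)), bookkeeping] -/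
theorem letters313_iff (R₀ : ℝ) (H₀ : Prop) (hG : GeoOK g) (B₃ δ₃ : ℝ) (U : (bg9Y 𝔸 G x).Cfg) :
    Letters313 (ops312RY 𝔬) R₀ H₀ hG B₃ δ₃ U ↔ Letters313 𝔬 R₀ H₀ hG B₃ δ₃ U := by
  constructor <;> rintro ⟨⟩ <;> constructor <;> assumption
omit [Fintype W] in
/-- `Letters313D` under the transport. [cite: Balaban1985BackgroundPropagators, Thm 3.13 p.426 + (3.152)–(3.153) p.426 + (3.42)–(3.44) pp.397–398 + (3.49) p.399, bookkeeping] -/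
theorem letters313D_iff (R₀ : ℝ) (H₀ : Prop) (hG : GeoOK g) (B₃ δ₃ : ℝ) (bH : BlockNorm (toB6 g R₀ H₀) (W → ℝ)) (U : (bg9Y 𝔸 G x).Cfg) :
    Letters313D (ops312RY 𝔬) R₀ H₀ hG B₃ δ₃ bH U ↔ Letters313D 𝔬 R₀ H₀ hG B₃ δ₃ bH U := by
  constructor <;> rintro ⟨⟩ <;> constructor <;> assumption
omit [Fintype W] in
/-- `Letters313DZ` under the transport. [cite: Balaban1985BackgroundPropagators, Thm 3.13 p.426 + (3.152)–(3.153) p.426 + (3.42)–(3.44) pp.397–398 + (3.49) p.399, bookkeeping] -/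
theorem letters313DZ_iff (R₀ : ℝ) (H₀ : Prop) (hG : GeoOK g) (wZ : g.Site → ℝ) (hwZ : ∀ y, 0 < wZ y) (B₃ δ₃ : ℝ) (bH : BlockNorm (toB6 g R₀ H₀) (W → ℝ))
    (U : (bg9Y 𝔸 G x).Cfg) :
    Letters313DZ (ops312RY 𝔬) R₀ H₀ hG wZ hwZ B₃ δ₃ bH U ↔ Letters313DZ 𝔬 R₀ H₀ hG wZ hwZ B₃ δ₃ bH U := by
  constructor <;> rintro ⟨⟩ <;> constructor <;> assumption
omit [Fintype Y] [Fintype W] [Fintype PY] [Fintype P] in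
/-- `Letters313DM` under the transport. [cite: Balaban1985BackgroundPropagators, Thm 3.13 p.426 + (3.126) p.420 + (3.42)–(3.44) pp.397–398 + (3.40) p.397 + (3.39) p.397, bookkeeping] -/
theorem letters313DM_iff (Dd : (bg9Y 𝔸 G x).Cfg → P → Module.End ℝ (X → ℝ)) (R₀ : ℝ) (H₀ : Prop) (hG : GeoOK g) (B₃ : ℝ) (Bq : ℝ → ℝ) (δ₃ : ℝ)
    (bH : BlockNorm (toB6 g R₀ H₀) (W → ℝ)) (U : (bg9Y 𝔸 G x).Cfg) :
    Letters313DM (ops312RY 𝔬) (holderProbesRY 𝔭) Dd R₀ H₀ hG B₃ Bq δ₃ bH U ↔ Letters313DM 𝔬 𝔭 Dd R₀ H₀ hG B₃ Bq δ₃ bH U := by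
  constructor <;> rintro ⟨⟩ <;> constructor <;> assumption
omit [Fintype Y] [Fintype W] [Fintype PY] [Fintype P] in
/-- `Letters313DMZ` under the transport. [cite: Balaban1985BackgroundPropagators, Thm 3.13 p.426 + (3.126) p.420 + (3.42)–(3.44) pp.397–398 + (3.40) p.397 + (3.39) p.397, bookkeeping] -/
theorem letters313DMZ_iff (Dd : (bg9Y 𝔸 G x).Cfg → P → Module.End ℝ (X → ℝ)) (R₀ : ℝ) (H₀ : Prop) (hG : GeoOK g) (wZ : g.Site → ℝ) (hwZ : ∀ y, 0 < wZ y)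
    (B₃ : ℝ) (Bq : ℝ → ℝ) (δ₃ : ℝ) (bH : BlockNorm (toB6 g R₀ H₀) (W → ℝ)) (U : (bg9Y 𝔸 G x).Cfg) :
    Letters313DMZ (ops312RY 𝔬) (holderProbesRY 𝔭) Dd R₀ H₀ hG wZ hwZ B₃ Bq δ₃ bH U ↔ Letters313DMZ 𝔬 𝔭 Dd R₀ H₀ hG wZ hwZ B₃ Bq δ₃ bH U := by
  constructor <;> rintro ⟨⟩ <;> constructor <;> assumption
omit [Fintype X] [Fintype Y] in
/-- `Letters313H` under the transport. [cite: Balaban1985BackgroundPropagators, Thm 3.13 p.426 + (3.152)–(3.153) p.426 + (3.43)–(3.45) p.398 + (3.49) p.399, bookkeeping] -/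
theorem letters313H_iff (R₀ : ℝ) (H₀ : Prop) (hlen : ∀ y : g.Site, 0 ≤ g.len y) (bW : BlockNorm (toB6 g R₀ H₀) (W → ℝ)) (BhD Bx : ℝ → ℝ) (δ₃ : ℝ)
    (U : (bg9Y 𝔸 G x).Cfg) :
    Letters313H (ops312RY 𝔬) (holderProbesRY 𝔭) R₀ H₀ hlen bW BhD Bx δ₃ U ↔ Letters313H 𝔬 𝔭 R₀ H₀ hlen bW BhD Bx δ₃ U := by
  constructor <;> rintro ⟨⟩ <;> constructor <;> assumption
omit [Fintype X] [Fintype Y] in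
/-- `Letters313HZ` under the transport. [cite: Balaban1985BackgroundPropagators, Thm 3.13 p.426 + (3.152)–(3.153) p.426 + (3.43)–(3.45) p.398 + (3.49) p.399, bookkeeping] -/
theorem letters313HZ_iff (R₀ : ℝ) (H₀ : Prop) (hG : GeoOK g) (wZ : g.Site → ℝ) (hwZ : ∀ y, 0 < wZ y) (bW : BlockNorm (toB6 g R₀ H₀) (W → ℝ)) (BhD Bx : ℝ → ℝ)
    (δ₃ : ℝ) (U : (bg9Y 𝔸 G x).Cfg) :
    Letters313HZ (ops312RY 𝔬) (holderProbesRY 𝔭) R₀ H₀ hG wZ hwZ bW BhD Bx δ₃ U ↔ Letters313HZ 𝔬 𝔭 R₀ H₀ hG wZ hwZ bW BhD Bx δ₃ U := by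
  constructor <;> rintro ⟨⟩ <;> constructor <;> assumption
omit [Fintype X] [Fintype Y] [Fintype W] in
/-- `Letters313HZc` under the transport. [cite: Balaban1985BackgroundPropagators, Thm 3.13 p.426 + (3.152)–(3.153) p.426 + (3.43)–(3.45) p.398 + (3.49) p.399, bookkeeping] -/
theorem letters313HZc_iff (Gp : (bg9Y 𝔸 G x).Cfg → Module.End ℝ (W → ℝ)) (R₀ : ℝ) (H₀ : Prop) (hG : GeoOK g) (wZ : g.Site → ℝ) (hwZ : ∀ y, 0 < wZ y)
    (bW : BlockNorm (toB6 g R₀ H₀) (W → ℝ)) (BhD Bx : ℝ → ℝ) (δ₃ : ℝ) (bXH : BlockNorm (toB6 g R₀ H₀) (X → ℝ)) (U : (bg9Y 𝔸 G x).Cfg) :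
    Letters313HZc (ops312RY 𝔬) (holderProbesRY 𝔭) Gp R₀ H₀ hG wZ hwZ bW BhD Bx δ₃ bXH U ↔ Letters313HZc 𝔬 𝔭 Gp R₀ H₀ hG wZ hwZ bW BhD Bx δ₃ bXH U := by
  constructor <;> rintro ⟨⟩ <;> constructor <;> assumption
omit [Fintype Z] [Fintype W] [Fintype PX] in
/-- `Letters313I` under the transport. [cite: Balaban1985BackgroundPropagators, Thm 3.13 p.426 + (3.152)–(3.153) p.426 + (3.44)–(3.45) p.398 + (3.41) p.397 + (3.130)–(3.131) pp.421–422, bookkeeping] -/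
theorem letters313I_iff (R₀ : ℝ) (H₀ : Prop) (hlen : ∀ y : g.Site, 0 ≤ g.len y) (bHY : ℝ → BlockNorm (toB6 g R₀ H₀) (Y → ℝ))
    (bHW : ℝ → BlockNorm (toB6 g R₀ H₀) (W → ℝ)) (Br θv : ℝ) (Bd : ℝ → ℝ) (Bd2 : ℝ → ℝ → ℝ) (δ₃ δK : ℝ) (U : (bg9Y 𝔸 G x).Cfg) :
    Letters313I (ops312RY 𝔬) (holderProbesRY 𝔭) R₀ H₀ hlen bHY bHW Br θv Bd Bd2 δ₃ δK U ↔ Letters313I 𝔬 𝔭 R₀ H₀ hlen bHY bHW Br θv Bd Bd2 δ₃ δK U := by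
  constructor <;> rintro ⟨⟩ <;> constructor <;> assumption
omit [Fintype Y] [Fintype Z] [Fintype W] [Fintype PY] [Fintype P] in
/-- `Letters313IM` under the transport. [cite: Balaban1985BackgroundPropagators, Thm 3.13 p.426 + (3.152)–(3.153) p.426 + (3.44)–(3.45) p.398 + (3.39)–(3.41) p.397 + (3.130)–(3.131) pp.421–422, bookkeeping] -/
theorem letters313IM_iff (Dd Dds : (bg9Y 𝔸 G x).Cfg → P → Module.End ℝ (X → ℝ)) (R₀ : ℝ) (H₀ : Prop) (hlen : ∀ y : g.Site, 0 ≤ g.len y)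
    (bHX : ℝ → BlockNorm (toB6 g R₀ H₀) (X → ℝ)) (bHW : ℝ → BlockNorm (toB6 g R₀ H₀) (W → ℝ)) (Br θv : ℝ) (Bd : ℝ → ℝ) (Bd2 : ℝ → ℝ → ℝ) (δ₃ δK : ℝ)
    (U : (bg9Y 𝔸 G x).Cfg) :
    Letters313IM (ops312RY 𝔬) (holderProbesRY 𝔭) Dd Dds R₀ H₀ hlen bHX bHW Br θv Bd Bd2 δ₃ δK U ↔ Letters313IM 𝔬 𝔭 Dd Dds R₀ H₀ hlen bHX bHW Br θv Bd Bd2 δ₃ δK U := by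
  constructor <;> rintro ⟨⟩ <;> constructor <;> assumption
omit [Fintype Y] [Fintype Z] [Fintype W] [Fintype PY] [Fintype P] in
/-- `Letters313IMB` under the transport. [cite: Balaban1985BackgroundPropagators, Thm 3.13 p.426 + (3.152)–(3.153) p.426 + (3.44)–(3.45) p.398 + (3.39)–(3.41) p.397 + (3.130)–(3.131) pp.421–422, bookkeeping] -/
theorem letters313IMB_iff (Dd Dds : (bg9Y 𝔸 G x).Cfg → P → Module.End ℝ (X → ℝ)) (R₀ : ℝ) (H₀ : Prop) (hlen : ∀ y : g.Site, 0 ≤ g.len y)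
    (bHX : ℝ → BlockNorm (toB6 g R₀ H₀) (X → ℝ)) (bHW : ℝ → BlockNorm (toB6 g R₀ H₀) (W → ℝ)) (Br θv : ℝ → ℝ) (Bd : ℝ → ℝ) (Bd2 : ℝ → ℝ → ℝ) (δ₃ δK : ℝ)
    (U : (bg9Y 𝔸 G x).Cfg) :
    Letters313IMB (ops312RY 𝔬) (holderProbesRY 𝔭) Dd Dds R₀ H₀ hlen bHX bHW Br θv Bd Bd2 δ₃ δK U ↔ Letters313IMB 𝔬 𝔭 Dd Dds R₀ H₀ hlen bHX bHW Br θv Bd Bd2 δ₃ δK U := by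
  constructor <;> rintro ⟨⟩ <;> constructor <;> assumption
omit [Fintype Y] [Fintype Z] [Fintype W] [Fintype PY] [Fintype P] in
/-- `Letters313IMBC` under the transport. [cite: Balaban1985BackgroundPropagators, Thm 3.13 p.426 + (3.152)–(3.153) p.426 + (3.44)–(3.45) p.398 + (3.39)–(3.41) p.397, bookkeeping] -/
theorem letters313IMBC_iff (Dd Dds : (bg9Y 𝔸 G x).Cfg → P → Module.End ℝ (X → ℝ)) (R₀ : ℝ) (H₀ : Prop) (hlen : ∀ y : g.Site, 0 ≤ g.len y)
    (bHX : ℝ → BlockNorm (toB6 g R₀ H₀) (X → ℝ)) (bHW : ℝ → BlockNorm (toB6 g R₀ H₀) (W → ℝ)) (Br θv : ℝ → ℝ) (Bd : ℝ → ℝ) (Bd2 : ℝ → ℝ → ℝ) (δ₃ δK : ℝ)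
    (Rel : g.Site → g.Site → Prop) (U : (bg9Y 𝔸 G x).Cfg) :
    Letters313IMBC (ops312RY 𝔬) (holderProbesRY 𝔭) Dd Dds R₀ H₀ hlen bHX bHW Br θv Bd Bd2 δ₃ δK Rel U ↔
      Letters313IMBC 𝔬 𝔭 Dd Dds R₀ H₀ hlen bHX bHW Br θv Bd Bd2 δ₃ δK Rel U := by
  constructor <;> rintro ⟨⟩ <;> constructor <;> assumption
omit [Fintype Y] [Fintype Z] [Fintype W] [Fintype PY] [Fintype P] in
/-- `Letters313IML` under the transport. [cite: Balaban1985BackgroundPropagators, Thm 3.13 p.426 + (3.152)–(3.153) p.426 + (3.44)–(3.45) p.398, bookkeeping] -/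
theorem letters313IML_iff (Dd Dds : (bg9Y 𝔸 G x).Cfg → P → Module.End ℝ (X → ℝ)) (R₀ : ℝ) (H₀ : Prop) (hlen : ∀ y : g.Site, 0 ≤ g.len y)
    (bHX : ℝ → BlockNorm (toB6 g R₀ H₀) (X → ℝ)) (bHW : ℝ → BlockNorm (toB6 g R₀ H₀) (W → ℝ)) (Br θv : ℝ → ℝ) (Bd : ℝ → ℝ) (Bd2 : ℝ → ℝ → ℝ) (δ₃ δK : ℝ)
    (U : (bg9Y 𝔸 G x).Cfg) :
    Letters313IML (ops312RY 𝔬) (holderProbesRY 𝔭) Dd Dds R₀ H₀ hlen bHX bHW Br θv Bd Bd2 δ₃ δK U ↔ Letters313IML 𝔬 𝔭 Dd Dds R₀ H₀ hlen bHX bHW Br θv Bd Bd2 δ₃ δK U := by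
  constructor <;> rintro ⟨⟩ <;> constructor <;> assumption
/-- `Letters313L2` under the transport. [cite: Balaban1985BackgroundPropagators, Thm 3.13 p.426 + (3.152)–(3.153) p.426 + (3.132) p.422 + (3.126) p.420 + (3.46) p.398 + p.398 (remark after (3.47)), bookkeeping] -/
theorem letters313L2_iff (Lap : (bg9Y 𝔸 G x).Cfg → Module.End ℝ (X → ℝ)) (R₀ : ℝ) (H₀ : Prop) (B₄ δ : ℝ) (U : (bg9Y 𝔸 G x).Cfg) :
    Letters313L2 (ops312RY 𝔬) Lap R₀ H₀ B₄ δ U ↔ Letters313L2 𝔬 Lap R₀ H₀ B₄ δ U := by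
  constructor <;> rintro ⟨⟩ <;> constructor <;> assumption
/-- `Letters313L2Z` under the transport. [cite: Balaban1985BackgroundPropagators, Thm 3.13 p.426 + (3.152)–(3.153) p.426 + (3.132) p.422 + (3.126) p.420 + (3.46) p.398 + p.398 (remark after (3.47)), bookkeeping] -/
theorem letters313L2Z_iff (Lap : (bg9Y 𝔸 G x).Cfg → Module.End ℝ (X → ℝ)) (R₀ : ℝ) (H₀ : Prop) (B₄ δ : ℝ) (vZ : g.Site → ℝ) (hvZ : ∀ y, 0 < vZ y)
    (U : (bg9Y 𝔸 G x).Cfg) :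
    Letters313L2Z (ops312RY 𝔬) Lap R₀ H₀ B₄ δ vZ hvZ U ↔ Letters313L2Z 𝔬 Lap R₀ H₀ B₄ δ vZ hvZ U := by
  constructor <;> rintro ⟨⟩ <;> constructor <;> assumption
omit [Fintype P] in
/-- `Letters313L2P` under the transport. [cite: Balaban1985BackgroundPropagators, Thm 3.13 p.426 + (3.152)–(3.153) p.426 + (3.132) p.422 + (3.126) p.420 + (3.46) p.398 + (3.39) p.397 + p.398 (remark after (3.47)), bookkeeping] -/
theorem letters313L2P_iff (Dd Dds : (bg9Y 𝔸 G x).Cfg → P → Module.End ℝ (X → ℝ)) (R₀ : ℝ) (H₀ : Prop) (B₄ δ : ℝ) (U : (bg9Y 𝔸 G x).Cfg) :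
    Letters313L2P (ops312RY 𝔬) Dd Dds R₀ H₀ B₄ δ U ↔ Letters313L2P 𝔬 Dd Dds R₀ H₀ B₄ δ U := by
  constructor <;> rintro ⟨⟩ <;> constructor <;> assumption
omit [Fintype P] in
/-- `Letters313L2PZ` under the transport. [cite: Balaban1985BackgroundPropagators, Thm 3.13 p.426 + (3.152)–(3.153) p.426 + (3.132) p.422 + (3.126) p.420 + (3.46) p.398 + (3.39) p.397 + p.398 (remark after (3.47)), bookkeeping] -/
theorem letters313L2PZ_iff (Dd Dds : (bg9Y 𝔸 G x).Cfg → P → Module.End ℝ (X → ℝ)) (R₀ : ℝ) (H₀ : Prop) (B₄ δ : ℝ) (vZ : g.Site → ℝ) (hvZ : ∀ y, 0 < vZ y)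
    (U : (bg9Y 𝔸 G x).Cfg) :
    Letters313L2PZ (ops312RY 𝔬) Dd Dds R₀ H₀ B₄ δ vZ hvZ U ↔ Letters313L2PZ 𝔬 Dd Dds R₀ H₀ B₄ δ vZ hvZ U := by
  constructor <;> rintro ⟨⟩ <;> constructor <;> assumption
omit [Fintype P] in
/-- `Letters313L2Pc` under the transport. [cite: Balaban1985BackgroundPropagators, Thm 3.13 p.426 + (3.152)–(3.153) p.426 + (3.132) p.422 + (3.126) p.420 + (3.46) p.398 + (3.39) p.397 + (3.49) p.399 + p.398 (remark after (3.47)), bookkeeping] -/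
theorem letters313L2Pc_iff (Dd Dds : (bg9Y 𝔸 G x).Cfg → P → Module.End ℝ (X → ℝ)) (R₀ : ℝ) (H₀ : Prop) (B₄ δ : ℝ) (vZ : g.Site → ℝ) (hvZ : ∀ y, 0 < vZ y)
    (U : (bg9Y 𝔸 G x).Cfg) :
    Letters313L2Pc (ops312RY 𝔬) Dd Dds R₀ H₀ B₄ δ vZ hvZ U ↔ Letters313L2Pc 𝔬 Dd Dds R₀ H₀ B₄ δ vZ hvZ U := by
  constructor <;> rintro ⟨⟩ <;> constructor <;> assumption
omit [Fintype P] in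
/-- `Letters313L2Pk` under the transport. [cite: Balaban1985BackgroundPropagators, Thm 3.13 p.426 + (3.46) p.398 + (3.152)–(3.153) p.426, bookkeeping] -/
theorem letters313L2Pk_iff (Dd Dds : (bg9Y 𝔸 G x).Cfg → P → Module.End ℝ (X → ℝ)) (R₀ : ℝ) (H₀ : Prop) (B₄ δ : ℝ) (vZ : g.Site → ℝ) (hvZ : ∀ y, 0 < vZ y)
    (U : (bg9Y 𝔸 G x).Cfg) :
    Letters313L2Pk (ops312RY 𝔬) Dd Dds R₀ H₀ B₄ δ vZ hvZ U ↔ Letters313L2Pk 𝔬 Dd Dds R₀ H₀ B₄ δ vZ hvZ U := by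
  constructor <;> rintro ⟨⟩ <;> constructor <;> assumption
omit [Fintype Y] [Fintype P] in
/-- `Letters313L2M` under the transport. [cite: Balaban1985BackgroundPropagators, Thm 3.13 p.426 + (3.152)–(3.153) p.426 + (3.46) p.398 + (3.39) p.397 + p.398 (remark after (3.47)), bookkeeping] -/
theorem letters313L2M_iff (Dd Dds : (bg9Y 𝔸 G x).Cfg → P → Module.End ℝ (X → ℝ)) (R₀ : ℝ) (H₀ : Prop) (B₄ δ : ℝ) (U : (bg9Y 𝔸 G x).Cfg) :
    Letters313L2M (ops312RY 𝔬) Dd Dds R₀ H₀ B₄ δ U ↔ Letters313L2M 𝔬 Dd Dds R₀ H₀ B₄ δ U := by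
  constructor <;> rintro ⟨⟩ <;> constructor <;> assumption
omit [Fintype Y] [Fintype P] in
/-- `Letters313L2MZ` under the transport. [cite: Balaban1985BackgroundPropagators, Thm 3.13 p.426 + (3.152)–(3.153) p.426 + (3.46) p.398 + (3.39) p.397 + p.398 (remark after (3.47)), bookkeeping] -/
theorem letters313L2MZ_iff (Dd Dds : (bg9Y 𝔸 G x).Cfg → P → Module.End ℝ (X → ℝ)) (R₀ : ℝ) (H₀ : Prop) (B₄ δ : ℝ) (vZ : g.Site → ℝ) (hvZ : ∀ y, 0 < vZ y)
    (U : (bg9Y 𝔸 G x).Cfg) :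
    Letters313L2MZ (ops312RY 𝔬) Dd Dds R₀ H₀ B₄ δ vZ hvZ U ↔ Letters313L2MZ 𝔬 Dd Dds R₀ H₀ B₄ δ vZ hvZ U := by
  constructor <;> rintro ⟨⟩ <;> constructor <;> assumption
/-- `Letters313Z` under the transport. [cite: Balaban1985BackgroundPropagators, Thm 3.13 p.426 + (3.152)–(3.153) p.426 + (3.132) p.422 + (3.126) p.420 + p.398 (remark after (3.47)), bookkeeping] -/
theorem letters313Z_iff (R₀ : ℝ) (H₀ : Prop) (hG : GeoOK g) (wZ : g.Site → ℝ) (hwZ : ∀ y, 0 < wZ y) (B₃ δ₃ : ℝ) (U : (bg9Y 𝔸 G x).Cfg) :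
    Letters313Z (ops312RY 𝔬) R₀ H₀ hG wZ hwZ B₃ δ₃ U ↔ Letters313Z 𝔬 R₀ H₀ hG wZ hwZ B₃ δ₃ U := by
  constructor <;> rintro ⟨⟩ <;> constructor <;> assumption
/-- `Letters313Zc` under the transport. [cite: Balaban1985BackgroundPropagators, Thm 3.13 p.426 + (3.152)–(3.153) p.426 + (3.132) p.422 + (3.126) p.420 + (3.42)–(3.44) pp.397–398 + (3.49) p.399, bookkeeping] -/
theorem letters313Zc_iff (Gp : (bg9Y 𝔸 G x).Cfg → Module.End ℝ (W → ℝ)) (R₀ : ℝ) (H₀ : Prop) (hG : GeoOK g) (wZ : g.Site → ℝ) (hwZ : ∀ y, 0 < wZ y) (B₃ δ₃ : ℝ)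
    (bXH : BlockNorm (toB6 g R₀ H₀) (X → ℝ)) (U : (bg9Y 𝔸 G x).Cfg) :
    Letters313Zc (ops312RY 𝔬) Gp R₀ H₀ hG wZ hwZ B₃ δ₃ bXH U ↔ Letters313Zc 𝔬 Gp R₀ H₀ hG wZ hwZ B₃ δ₃ bXH U := by
  constructor <;> rintro ⟨⟩ <;> constructor <;> assumption
omit [Fintype Y] in
/-- `Letters313Zk` under the transport. [cite: Balaban1985BackgroundPropagators, Thm 3.13 p.426 + (3.42) p.397 + (3.152)–(3.153) p.426, bookkeeping] -/
theorem letters313Zk_iff (R₀ : ℝ) (H₀ : Prop) (hG : GeoOK g) (wZ : g.Site → ℝ) (hwZ : ∀ y, 0 < wZ y) (B₃ δ₃ : ℝ) (U : (bg9Y 𝔸 G x).Cfg) :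
    Letters313Zk (ops312RY 𝔬) R₀ H₀ hG wZ hwZ B₃ δ₃ U ↔ Letters313Zk 𝔬 R₀ H₀ hG wZ hwZ B₃ δ₃ U := by
  constructor <;> rintro ⟨⟩ <;> constructor <;> assumption

/-! ## §4 ★★ The remaining Sect.-D schemas over `Ops g B X Y Z W`: identities, form smallness, the (3.130) ∕ (3.137) steps, the `H`-letters -/

omit [Fintype g.Site] [Fintype Y] [Fintype Z] [Fintype W] in
/-- `FormSmall` under the transport. [cite: Balaban1985BackgroundPropagators, Thm 3.11 p.416, (3.120) p.419, (3.131) p.422, (3.137) p.423, bookkeeping] -/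
theorem formSmall_iff (r : ℝ) (U : (bg9Y 𝔸 G x).Cfg) :
    FormSmall (ops312RY 𝔬) r U ↔ FormSmall 𝔬 r U := by
  constructor <;> rintro ⟨⟩ <;> constructor <;> assumption
omit [Fintype g.Site] [Fintype Y] in
/-- `Identities` under the transport (named `identities312_iff`: `B9OpsRTransport.identities_iff` is Theorem 3.7’s `Identities`). [cite: Balaban1985BackgroundPropagators, (3.120)–(3.130) pp.419–421, (3.147) p.425, (3.152)–(3.153) p.426, bookkeeping] -/
theorem identities312_iff (U : (bg9Y 𝔸 G x).Cfg) :
    Identities (ops312RY 𝔬) U ↔ Identities 𝔬 U := by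
  constructor <;> rintro ⟨⟩ <;> constructor <;> assumption
omit [Fintype g.Site] [Fintype Y] in
/-- `IdentitiesDef` under the transport. [cite: Balaban1985BackgroundPropagators, (3.120)–(3.130) pp.419–421 + (3.147) p.425 + (3.152)–(3.153) p.426, bookkeeping] -/
theorem identitiesDef_iff (U : (bg9Y 𝔸 G x).Cfg) :
    IdentitiesDef (ops312RY 𝔬) U ↔ IdentitiesDef 𝔬 U := by
  constructor <;> rintro ⟨⟩ <;> constructor <;> assumption
omit [Fintype g.Site] [Fintype X] [Fintype Y] [Fintype Z] [Fintype W] in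
/-- `Ids3124` under the transport. [cite: Balaban1985BackgroundPropagators, (3.124) p.420 + (3.115) p.418 + (3.147) p.425, bookkeeping] -/
theorem ids3124_iff (U : (bg9Y 𝔸 G x).Cfg) :
    Ids3124 (ops312RY 𝔬) U ↔ Ids3124 𝔬 U := by
  constructor <;> rintro ⟨⟩ <;> constructor <;> assumption
omit [Fintype g.Site] [Fintype X] [Fintype Y] [Fintype Z] [Fintype W] in
/-- `Ids3152` under the transport. [cite: Balaban1985BackgroundPropagators, (3.152) p.426 + (3.151) p.425 + (3.124) p.420, bookkeeping] -/
theorem ids3152_iff (Gp : (bg9Y 𝔸 G x).Cfg → Module.End ℝ (W → ℝ)) (U : (bg9Y 𝔸 G x).Cfg) :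
    Ids3152 (ops312RY 𝔬) Gp U ↔ Ids3152 𝔬 Gp U := by
  constructor <;> rintro ⟨⟩ <;> constructor <;> assumption
omit [Fintype Z] [Fintype W] in
/-- `LeftStep` under the transport. [cite: Balaban1985BackgroundPropagators, Thm 3.3 p.399 + (3.42) p.397 + (3.130)–(3.131) pp.421–422 + (3.137)–(3.138) p.423, bookkeeping] -/
theorem leftStep_iff (R₀ : ℝ) (H₀ : Prop) (hlen : ∀ y : g.Site, 0 ≤ g.len y) (B₀ δ₀ θ δK : ℝ) (U : (bg9Y 𝔸 G x).Cfg) :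
    LeftStep (ops312RY 𝔬) R₀ H₀ hlen B₀ δ₀ θ δK U ↔ LeftStep 𝔬 R₀ H₀ hlen B₀ δ₀ θ δK U := by
  constructor <;> rintro ⟨⟩ <;> constructor <;> assumption
omit [Fintype W] in
/-- `LettersH` under the transport. [cite: Balaban1985BackgroundPropagators, (3.132) p.422 + (3.126) p.420 + (3.129) p.421 + Thm 3.3 p.399 + p.398 (remark after (3.47)), bookkeeping] -/
theorem lettersH_iff (R₀ : ℝ) (H₀ : Prop) (hG : GeoOK g) (B₃ δ₃ : ℝ) (U : (bg9Y 𝔸 G x).Cfg) :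
    LettersH (ops312RY 𝔬) R₀ H₀ hG B₃ δ₃ U ↔ LettersH 𝔬 R₀ H₀ hG B₃ δ₃ U := by
  constructor <;> rintro ⟨⟩ <;> constructor <;> assumption
omit [Fintype X] [Fintype Y] [Fintype W] [Fintype PX] in
/-- `LettersHH` under the transport. [cite: Balaban1985BackgroundPropagators, (3.133) p.422 + (3.126) p.420 + (3.43) p.398 + Thm 3.3 p.399, bookkeeping] -/
theorem lettersHH_iff (R₀ : ℝ) (H₀ : Prop) (hlen : ∀ y : g.Site, 0 ≤ g.len y) (Bq : ℝ → ℝ) (δ₃ : ℝ) (U : (bg9Y 𝔸 G x).Cfg) :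
    LettersHH (ops312RY 𝔬) (holderProbesRY 𝔭) R₀ H₀ hlen Bq δ₃ U ↔ LettersHH 𝔬 𝔭 R₀ H₀ hlen Bq δ₃ U := by
  constructor <;> rintro ⟨⟩ <;> constructor <;> assumption
omit [Fintype X] [Fintype Y] [Fintype Z] [Fintype W] [Fintype PX] in
/-- `LettersHHZ` under the transport. [cite: Balaban1985BackgroundPropagators, (3.133) p.422 + (3.126) p.420 + (3.43) p.398 + Thm 3.3 p.399, bookkeeping] -/
theorem lettersHHZ_iff (R₀ : ℝ) (H₀ : Prop) (hlen : ∀ y : g.Site, 0 ≤ g.len y) (bZ : BlockNorm (toB6 g R₀ H₀) (Z → ℝ)) (Bq : ℝ → ℝ) (δ₃ : ℝ)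
    (U : (bg9Y 𝔸 G x).Cfg) :
    LettersHHZ (ops312RY 𝔬) (holderProbesRY 𝔭) R₀ H₀ hlen bZ Bq δ₃ U ↔ LettersHHZ 𝔬 𝔭 R₀ H₀ hlen bZ Bq δ₃ U := by
  constructor <;> rintro ⟨⟩ <;> constructor <;> assumption
omit [Fintype Y] [Fintype Z] [Fintype W] in
/-- `Step` under the transport. [cite: Balaban1985BackgroundPropagators, (3.130)–(3.131) pp.421–422 + (3.137)–(3.138) p.423, bookkeeping] -/
theorem step_iff (R₀ : ℝ) (H₀ : Prop) (hlen : ∀ y : g.Site, 0 ≤ g.len y) (p : ℕ) (θ δK : ℝ) (U : (bg9Y 𝔸 G x).Cfg) :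
    Step (ops312RY 𝔬) R₀ H₀ hlen p θ δK U ↔ Step 𝔬 R₀ H₀ hlen p θ δK U := by
  constructor <;> rintro ⟨⟩ <;> constructor <;> assumption
omit [Fintype Y] [Fintype Z] [Fintype W] [Fintype P] in
/-- `StepDir` under the transport. [cite: Balaban1985BackgroundPropagators, (3.130)–(3.131) pp.421–422 + (3.137)–(3.138) p.423 + (3.42)–(3.45) p.398 + (3.39) p.397, bookkeeping] -/
theorem stepDir_iff (Dd Dds : (bg9Y 𝔸 G x).Cfg → P → Module.End ℝ (X → ℝ)) (R₀ : ℝ) (H₀ : Prop) (bHX : ℝ → BlockNorm (toB6 g R₀ H₀) (X → ℝ))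
    (hlen : ∀ y : g.Site, 0 ≤ g.len y) (θD θH δK : ℝ) (U : (bg9Y 𝔸 G x).Cfg) :
    StepDir (ops312RY 𝔬) (holderProbesRY 𝔭) Dd Dds R₀ H₀ bHX hlen θD θH δK U ↔ StepDir 𝔬 𝔭 Dd Dds R₀ H₀ bHX hlen θD θH δK U := by
  constructor <;> rintro ⟨⟩ <;> constructor <;> assumption
omit [Fintype Y] [Fintype Z] [Fintype W] [Fintype P] in
/-- `StepDirB` under the transport. [cite: Balaban1985BackgroundPropagators, (3.130)–(3.131) pp.421–422 + (3.137)–(3.138) p.423 + (3.42)–(3.45) pp.397–398 + (3.39) p.397, bookkeeping] -/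
theorem stepDirB_iff (Dd Dds : (bg9Y 𝔸 G x).Cfg → P → Module.End ℝ (X → ℝ)) (R₀ : ℝ) (H₀ : Prop) (bHX : ℝ → BlockNorm (toB6 g R₀ H₀) (X → ℝ))
    (hlen : ∀ y : g.Site, 0 ≤ g.len y) (θD : ℝ) (θH θI : ℝ → ℝ) (δK : ℝ) (U : (bg9Y 𝔸 G x).Cfg) :
    StepDirB (ops312RY 𝔬) (holderProbesRY 𝔭) Dd Dds R₀ H₀ bHX hlen θD θH θI δK U ↔ StepDirB 𝔬 𝔭 Dd Dds R₀ H₀ bHX hlen θD θH θI δK U := by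
  constructor <;> rintro ⟨⟩ <;> constructor <;> assumption
omit [Fintype Y] [Fintype Z] [Fintype W] in
/-- `StepH` under the transport. [cite: Balaban1985BackgroundPropagators, (3.130)–(3.131) pp.421–422 + (3.137)–(3.138) p.423 + (3.43)–(3.45) p.398, bookkeeping] -/
theorem stepH_iff (R₀ : ℝ) (H₀ : Prop) (bH : ℝ → BlockNorm (toB6 g R₀ H₀) (Y → ℝ)) (hlen : ∀ y : g.Site, 0 ≤ g.len y) (θ δK : ℝ) (U : (bg9Y 𝔸 G x).Cfg) :
    StepH (ops312RY 𝔬) (holderProbesRY 𝔭) R₀ H₀ bH hlen θ δK U ↔ StepH 𝔬 𝔭 R₀ H₀ bH hlen θ δK U := by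
  constructor <;> rintro ⟨⟩ <;> constructor <;> assumption
omit [Fintype Y] [Fintype Z] [Fintype W] in
/-- `StepL2` under the transport. [cite: Balaban1985BackgroundPropagators, (3.120) p.419 + (3.130)–(3.131) pp.421–422 + (3.135)–(3.138) pp.422–423, bookkeeping] -/
theorem stepL2_iff (R₀ : ℝ) (H₀ : Prop) (θ δ₁ : ℝ) (U : (bg9Y 𝔸 G x).Cfg) :
    StepL2 (ops312RY 𝔬) R₀ H₀ θ δ₁ U ↔ StepL2 𝔬 R₀ H₀ θ δ₁ U := by
  constructor <;> rintro ⟨⟩ <;> constructor <;> assumption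

end Literature.MathematicalPhysics.QuantumFieldTheory.Balaban1983to89.B9OpsRTransportSectD

end
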